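import Mathlib
import Summits.Ventures.PercRepro2.TypedTwoEdgeO

/-!
# The two-edge `o` at `a₃`, III: the class-`2` slot reduction (blind cell PercRepro2, mine-2 g53,
2026-08-29; `conjectures/MINE-2.md` M2-111 add. 1)

With `g₁ = {o, v}` of class `2` a placement of `g₁` has TWO open copies; the `o`-copy carries its
`o`-term `KO_c`, the other open copy may carry `g₂` (a BRIDGE: its non-`o` data is that of the
contracted instance with `{v, a₃}` open), and the closed copy is inert and does not see `g₂`.
**`typedCount_two_edge_o_slot_two`**: for a kernel term `G` with the `o`-factor in its first slot,
the count with `g₁` open in the first two copies and closed in the third is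

  `[τ g₂ ≤ 1] · N(G; g₂ closed) + [τ g₂ ∈ {1, 2}] · N(G; g₂ open in the second copy)`,

both counts on the instance with `g₁` pinned open.  Bookkeeping: the unconditional copy swap
`typedCount_swap23'` and the `Bool³` sum `sum_bool3_first_closed_second`.  The theorem
`TypedTwoEdgeOTwo.lean` sums the six (`o`-copy, other open copy) terms of the split at `g₁`.
Own work; standard axioms.
-/

namespace Summit.Ventures.PercRepro2

namespace CovForm

namespace TypedRed

open OneTyped

/-! ## Bookkeeping -/

section Book

variable {E : Type*} [Fintype E] [DecidableEq E] {R : Type*} [CommRing R]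

/-- Swapping the second and third copies does not change a typed count (no type hypothesis). -/
lemma typedCount_swap23' (F : Finset E) (z : Config E) (τ : E → ℕ)
    (K : Config E → Config E → Config E → R) :
    typedCount F z τ (fun x y w => K x w y) = typedCount F z τ K := by
  unfold typedCount
  have h : ∀ x y w : Config E,
      (if (∀ e, e ∉ F → x e = z e ∧ y e = z e ∧ w e = z e) ∧
          (∀ e ∈ F, openCount x y w e = τ e) then K x w y else 0) =
      (if (∀ e, e ∉ F → x e = z e ∧ w e = z e ∧ y e = z e) ∧
          (∀ e ∈ F, openCount x w y e = τ e) then K x w y else 0) := by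
    intro x y w
    refine if_congr ?_ rfl rfl
    have h1 : (∀ e, e ∉ F → x e = z e ∧ y e = z e ∧ w e = z e) ↔
        (∀ e, e ∉ F → x e = z e ∧ w e = z e ∧ y e = z e) := by
      constructor <;> intro h e he <;> obtain ⟨h1, h2, h3⟩ := h e he <;> exact ⟨h1, h3, h2⟩
    have h2 : (∀ e ∈ F, openCount x y w e = τ e) ↔ (∀ e ∈ F, openCount x w y e = τ e) := by
      constructor <;> intro h e he <;> rw [← h e he] <;> unfold openCount <;> ring
    rw [h1, h2]
  refine Finset.sum_congr rfl fun x _ => ?_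
  rw [Finset.sum_comm]
  refine Finset.sum_congr rfl fun w _ => Finset.sum_congr rfl fun y _ => ?_
  exact h x y w

/-- `Σ_{(a,b,c) ∈ Bool³, a+b+c = k} [a = false] · (if b then T₁ else T₀)
  = [k ≤ 1] T₀ + [k ∈ {1, 2}] T₁`. -/
lemma sum_bool3_first_closed_second (k : ℕ) (T₀ T₁ : R) :
    (∑ a : Bool, ∑ b : Bool, ∑ c : Bool, if a.toNat + b.toNat + c.toNat = k then
        (if a = false then (if b then T₁ else T₀) else 0) else 0) =
      (if k ≤ 1 then T₀ else 0) + (if k = 1 ∨ k = 2 then T₁ else 0) := by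
  simp only [Fintype.sum_bool, Bool.toNat_true, Bool.toNat_false, Bool.true_eq_false, if_false,
    if_true]
  rcases k with _ | _ | _ | k
  · norm_num
  · norm_num; ring
  · norm_num
  · norm_num
    omega

end Book

/-! ## The class-`2` slot reduction -/

section Slot

open Classical

variable {V : Type*} {E : Type*} [Fintype E] [DecidableEq E] {R : Type*} [Field R]
variable (ends : E → Sym2 V) (o a₁ a₂ a₃ b : V)

/-- **The class-`2` slot reduction**: for a kernel term `G` with the `o`-factor in its first slot,
the count with `g₁` open in the first two copies and closed in the third is the count of `G` with
`g₂` closed (when `τ g₂ ≤ 1`) plus the count of `G` with `g₂` open in the second copy (when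
`τ g₂ ∈ {1, 2}`), both on the instance with `g₁` pinned open. -/
theorem typedCount_two_edge_o_slot_two (G : St → St → St → ℤ)
    (hG0 : ∀ x y w : St, x.Lo = x.L3 → x.Ho = x.H3 → G x y w = 0)
    (hGw : ∀ x y w : St, G x y (killO w) = G x y w)
    {g₁ g₂ : E} {v : V} (hg₁ : ends g₁ = s(o, v)) (hg₂ : ends g₂ = s(o, a₃))
    (hdeg : ∀ e, o ∈ ends e → e = g₁ ∨ e = g₂) (hov : o ≠ v) (ho1 : o ≠ a₁) (ho2 : o ≠ a₂)
    (ho3 : o ≠ a₃) (hob : o ≠ b) (hg12 : g₁ ≠ g₂)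
    (F : Finset E) (hg₁F : g₁ ∉ F) (hg₂F : g₂ ∈ F) (z : Config E) (τ : E → ℕ) :
    typedCount F (Function.update z g₁ false) τ
        (fun x y w => ((G (st ends o a₁ a₂ a₃ b (Function.update x g₁ true))
          (st ends o a₁ a₂ a₃ b (Function.update y g₁ true))
          (st ends o a₁ a₂ a₃ b (Function.update w g₁ false)) : ℤ) : R)) =
      (if τ g₂ ≤ 1 then (1 : R) else 0) *
        typedCount (F.erase g₂) (Function.update (Function.update z g₁ true) g₂ false) τ
          (fun x y w => ((G (st ends o a₁ a₂ a₃ b x) (st ends o a₁ a₂ a₃ b y)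
            (st ends o a₁ a₂ a₃ b w) : ℤ) : R)) +
      (if τ g₂ = 1 ∨ τ g₂ = 2 then (1 : R) else 0) *
        typedCount (F.erase g₂) (Function.update (Function.update z g₁ true) g₂ false) τ
          (fun x y w => ((G (st ends o a₁ a₂ a₃ b x)
            (st ends o a₁ a₂ a₃ b (Function.update y g₂ true))
            (st ends o a₁ a₂ a₃ b w) : ℤ) : R)) := by
  set S := st ends o a₁ a₂ a₃ b with hS
  have hcl := killO_st_closed_eq ends o a₁ a₂ a₃ b hg₁ hg₂ hdeg hov ho1 ho2 ho3 hob hg12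
  -- Step 1: the pointwise reduction of the kernel
  have hred : ∀ x y w : Config E,
      ((G (S (Function.update x g₁ true)) (S (Function.update y g₁ true))
        (S (Function.update w g₁ false)) : ℤ) : R) =
      if x g₂ = false then
        ((G (S (Function.update (Function.update x g₁ true) g₂ false))
          (S (Function.update y g₁ true))
          (S (Function.update (Function.update w g₁ true) g₂ false)) : ℤ) : R)
      else 0 := by
    intro x y w
    rw [← hGw, hcl w, hGw]
    by_cases hx2 : x g₂ = false
    · rw [if_pos hx2]
      have : Function.update (Function.update x g₁ true) g₂ false =
          Function.update x g₁ true := by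
        refine Function.update_eq_self_iff.2 ?_
        rw [Function.update_of_ne hg12.symm]; exact hx2.symm
      rw [this]
    · rw [if_neg hx2]
      have hx2' : Function.update x g₁ true g₂ = true := by
        rw [Function.update_of_ne hg12.symm]; simpa using hx2
      obtain ⟨h1, h2⟩ := st_coinc_of_open ends o a₁ a₂ a₃ b hg₂ _ hx2'
      rw [hG0 _ _ _ h1 h2]
      push_cast
      rfl
  rw [typedCount_congr_K _ _ _ hred, typedCount_split F g₂ hg₂F]
  -- Step 2: the placements of `g₂` with the first copy closed, by the second copy
  set z₀ := Function.update (Function.update z g₁ false) g₂ false with hz₀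
  set C₀ : R := typedCount (F.erase g₂) z₀ τ
    (fun x y w => ((G (S (Function.update (Function.update x g₁ true) g₂ false))
      (S (Function.update (Function.update y g₁ true) g₂ false))
      (S (Function.update (Function.update w g₁ true) g₂ false)) : ℤ) : R)) with hC₀
  set C₁ : R := typedCount (F.erase g₂) z₀ τ
    (fun x y w => ((G (S (Function.update (Function.update x g₁ true) g₂ false))
      (S (Function.update (Function.update y g₁ true) g₂ true))
      (S (Function.update (Function.update w g₁ true) g₂ false)) : ℤ) : R)) with hC₁
  have hterm : ∀ a b c : Bool, typedCount (F.erase g₂) z₀ τ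
      (fun x y w => (fun x y w => if x g₂ = false then
        ((G (S (Function.update (Function.update x g₁ true) g₂ false))
          (S (Function.update y g₁ true))
          (S (Function.update (Function.update w g₁ true) g₂ false)) : ℤ) : R) else 0)
        (Function.update x g₂ a) (Function.update y g₂ b) (Function.update w g₂ c)) =
      if a = false then (if b then C₁ else C₀) else 0 := by
    intro a b c
    cases b
    · simp only [Bool.false_eq_true, if_false]
      rw [hC₀, ← typedCount_ite]
      refine typedCount_congr_K _ _ _ fun x y w => ?_
      show (if Function.update x g₂ a g₂ = false then _ else 0) = _
      rw [Function.update_self, Function.update_comm hg12.symm a true x,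
        Function.update_comm hg12.symm false true y, Function.update_comm hg12.symm c true w,
        Function.update_idem, Function.update_idem]
    · simp only [if_true]
      rw [hC₁, ← typedCount_ite]
      refine typedCount_congr_K _ _ _ fun x y w => ?_
      show (if Function.update x g₂ a g₂ = false then _ else 0) = _
      rw [Function.update_self, Function.update_comm hg12.symm a true x,
        Function.update_comm hg12.symm true true y, Function.update_comm hg12.symm c true w,
        Function.update_idem, Function.update_idem]
  simp only [hterm]
  rw [sum_bool3_first_closed_second (τ g₂) C₀ C₁]
  -- Step 3: re-pin `g₁` open in both counts
  have hg₁F' : g₁ ∉ F.erase g₂ := fun h => hg₁F (Finset.mem_erase.1 h).2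
  have hg₂F' : g₂ ∉ F.erase g₂ := fun h => (Finset.mem_erase.1 h).1 rfl
  have hz₁ : Function.update (Function.update (Function.update z g₁ true) g₂ false) g₁ false =
      z₀ := by
    rw [Function.update_comm hg12.symm false false (Function.update z g₁ true),
      Function.update_idem, hz₀]
  have hzg : Function.update (Function.update z g₁ true) g₂ false g₁ = true := by
    rw [Function.update_of_ne hg12, Function.update_self]
  have hsup : ∀ x : Config E, x g₂ = z₀ g₂ →
      Function.update (Function.update x g₁ true) g₂ false = Function.update x g₁ true := by
    intro x hx
    refine Function.update_eq_self_iff.2 ?_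
    rw [Function.update_of_ne hg12.symm, hx, hz₀, Function.update_self]
  have e0 : typedCount (F.erase g₂) (Function.update (Function.update z g₁ true) g₂ false) τ
      (fun x y w => ((G (S x) (S y) (S w) : ℤ) : R)) = C₀ := by
    rw [typedCount_repin_false (F.erase g₂) g₁ hg₁F', hzg, hz₁, hC₀]
    refine typedCount_congr_K_on _ _ _ fun x y w hagree _ => ?_
    rw [hsup x (hagree g₂ hg₂F').1, hsup y (hagree g₂ hg₂F').2.1, hsup w (hagree g₂ hg₂F').2.2]
  have e1 : typedCount (F.erase g₂) (Function.update (Function.update z g₁ true) g₂ false) τ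
      (fun x y w => ((G (S x) (S (Function.update y g₂ true)) (S w) : ℤ) : R)) = C₁ := by
    rw [typedCount_repin_false (F.erase g₂) g₁ hg₁F', hzg, hz₁, hC₁]
    refine typedCount_congr_K_on _ _ _ fun x y w hagree _ => ?_
    rw [hsup x (hagree g₂ hg₂F').1, hsup w (hagree g₂ hg₂F').2.2]
  rw [e0, e1]
  split_ifs <;> ring

end Slot

end TypedRed

end CovForm

end Summit.Ventures.PercRepro2
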